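import Literature.AlgebraicGeometry.Motives.FaltingsECTateFiniteProofs
import Literature.NumberTheory.EllipticCurves.IsogenyHomNsmulProofs
import Literature.NumberTheory.EllipticCurves.IsogenyGeomEndRingProofs
import HarnessLib

/-!
# Tate's theorem for `End_k(E)` over a finite field: the non-central case, unconditionally

Sibling file (D-0014 append protocol) of `Literature.AlgebraicGeometry.Motives.FaltingsEC`, for
its named fact `Literature.Hodge.mem_span_range_tateEndRingHom_iff_of_finite W ℓ` — Tate's theorem in
`End` form for an elliptic curve `E` over a finite field `k` and a prime `ℓ ≠ char k`: a
`ℤ_ℓ`-linear endomorphism of `T_ℓ E` lies in `ℤ_ℓ · End_k(E)` iff it commutes with `Γ_k`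
(Tate, Invent. Math. 2 (1966), Main Theorem; Silverman, *AEC*, Thm. III.7.7(a)).

The reduction of this fact in `FaltingsECTateFiniteProofs` (the non-central case: `ℓ^n g ∈
ℤ_ℓ · End_k(E)` from the commutant of a non-scalar Frobenius on the rank-two `T_ℓ E`, then
saturation, Tate §1 / *AEC* III.7.4) carries as hypotheses the two results of Silverman, *AEC*,
III.§4 on which it rests. Both are now theorems of the tree —

* `WeierstrassCurve.mem_geomEndRing_iff_holds` (`IsogenyGeomEndRingProofs`: `End_{K̄}(E)` is
  `{0} ∪ {algebraic endomorphisms}`, *AEC* III.§4),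
* `WeierstrassCurve.Isogeny.exists_eq_comp_nsmul_of_geomTorsion_le_ker_holds`
  (`IsogenyHomNsmulProofs`: an isogeny killing `E[m]`, `m ≠ 0` in `k`, factors through `[m]`,
  *AEC* Cor. III.4.11 with Cor. III.5.4) —

and this file feeds them in:

* `mem_span_range_tateEndRingHom_iff_of_not_smul_unconditional`,
  `mem_span_range_tateEndRingHom_of_equivariant_of_not_smul_unconditional`: **Tate's theorem in `End` form
  holds outright for every elliptic curve over a finite field whose Frobenius is not an `ℓ`-adic
  scalar on `T_ℓ E`** — all ordinary curves, and the supersingular ones with `π ∉ ℤ`;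
* `mem_span_range_tateEndRingHom_iff_of_finite_of_central_case`: the named fact follows from the
  `ℚ_ℓ`-statement in the single remaining (central, `π ∈ ℤ`) case alone.

(The complementary reduction of the whole named fact to the quotient-isogeny fact
`WeierstrassCurve.exists_isogeny_ker_eq_and_comp_eq_nsmul` of `IsogenyQuotient`, Silverman
III.4.12/III.6.1, through Tate's §2 argument, is the tree's
`mem_span_range_tateEndRingHom_iff_of_finite_of_quot_fact`, file `FaltingsECTateFiniteFactsProofs`;
the discharge `…_of_finite_holds` awaits the formalisation of III.4.12/III.6.1 for the prelude's
isogenies.)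

## References

* J. Tate, *Endomorphisms of abelian varieties over finite fields*, Invent. Math. 2 (1966),
  134–144, Main Theorem and §§1–2. [Tate1966Endomorphisms]
* J. H. Silverman, *The Arithmetic of Elliptic Curves*, 2nd ed., GTM 106, Springer 2009,
  Thm. III.7.7(a), Thm. III.7.4; III.§4 (Cor. III.4.11). [SilvermanAEC2009]

## Design

Theorems only (no `_holds` names: nothing here discharges a `Prop`-definition; the three results
are the tree's reductions with their *AEC* III.§4 hypotheses fed in); `namespace Literature.Hodge`, `(W : WeierstrassCurve K) (ℓ : ℕ) [Fact ℓ.Prime]`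
explicit as in `FaltingsEC`. Of the two tree files declaring
`Isogeny.exists_eq_comp_nsmul_of_geomTorsion_le_ker_holds`, this file imports
`IsogenyHomNsmulProofs`, the one imported by `FaltingsECTateFiniteFactsProofs`, so that the
`FaltingsECTate*Proofs` files have a common import closure.
-/

noncomputable section

open scoped Classical

universe u

namespace Literature.AlgebraicGeometry.Motives

open WeierstrassCurve

variable {K : Type u} [Field K] (W : WeierstrassCurve K) (ℓ : ℕ) [Fact ℓ.Prime]

/-- **Tate's theorem in `End` form, non-central case, unconditionally**: for `E` elliptic over a
finite field `k`, `ℓ ≠ char k`, and a Frobenius `σ_q ∈ Γ_k` which is not an `ℓ`-adic scalar on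
`T_ℓ E`, a `ℤ_ℓ`-linear endomorphism of `T_ℓ E` lies in `ℤ_ℓ · End_k(E)` iff it commutes with
`Γ_k`. (The tree's `mem_span_range_tateEndRingHom_iff_of_not_smul` with its hypotheses *AEC*
III.§4 and Cor. III.4.11 discharged by `mem_geomEndRing_iff_holds` and
`Isogeny.exists_eq_comp_nsmul_of_geomTorsion_le_ker_holds`.) Tate, Invent. Math. 2 (1966),
Main Theorem; Silverman, *AEC*, Thm. III.7.7(a). [cite: Tate1966Endomorphisms, Main Theorem] -/
theorem mem_span_range_tateEndRingHom_iff_of_not_smul_unconditional [Finite K] [W.IsElliptic]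
    (hℓ : (ℓ : K) ≠ 0) {σ : Field.absoluteGaloisGroup K}
    (hσ : ∀ x : AlgebraicClosure K, σ • x = x ^ Nat.card K)
    (hπ : ¬ ∃ c : ℤ_[ℓ], ∀ x : W.tateModule ℓ, σ • x = c • x)
    (g : Module.End ℤ_[ℓ] (W.tateModule ℓ)) :
    g ∈ Submodule.span ℤ_[ℓ] (Set.range (tateEndRingHom W ℓ)) ↔
      ∀ (τ : Field.absoluteGaloisGroup K) (x : W.tateModule ℓ), g (τ • x) = τ • g x :=
  mem_span_range_tateEndRingHom_iff_of_not_smul W ℓ hℓ (mem_geomEndRing_iff_holds W)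
    (Isogeny.exists_eq_comp_nsmul_of_geomTorsion_le_ker_holds W W) hσ hπ g

/-- **The `Γ_k`-equivariant endomorphisms of `T_ℓ E` lie in `ℤ_ℓ · End_k(E)`, non-central case,
unconditionally** (the substantive implication of the previous theorem).
Tate, Invent. Math. 2 (1966), Main Theorem. [cite: Tate1966Endomorphisms, Main Theorem] -/
theorem mem_span_range_tateEndRingHom_of_equivariant_of_not_smul_unconditional [Finite K] [W.IsElliptic]
    (hℓ : (ℓ : K) ≠ 0) {σ : Field.absoluteGaloisGroup K}
    (hσ : ∀ x : AlgebraicClosure K, σ • x = x ^ Nat.card K)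
    (hπ : ¬ ∃ c : ℤ_[ℓ], ∀ x : W.tateModule ℓ, σ • x = c • x)
    {g : Module.End ℤ_[ℓ] (W.tateModule ℓ)}
    (hg : ∀ (τ : Field.absoluteGaloisGroup K) (x : W.tateModule ℓ), g (τ • x) = τ • g x) :
    g ∈ Submodule.span ℤ_[ℓ] (Set.range (tateEndRingHom W ℓ)) :=
  mem_span_range_tateEndRingHom_of_equivariant_of_not_smul W ℓ hℓ (mem_geomEndRing_iff_holds W)
    (Isogeny.exists_eq_comp_nsmul_of_geomTorsion_le_ker_holds W W) hσ hπ hg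

/-- **The named fact from the central case alone**: `mem_span_range_tateEndRingHom_iff_of_finite
W ℓ` follows from the `ℚ_ℓ`-form of Tate's theorem for the curves whose Frobenius `σ_q` is an
`ℓ`-adic scalar on `T_ℓ E` (`E` supersingular with `π ∈ ℤ`; Tate, §2, Propositions 1–2) — the
tree's `mem_span_range_tateEndRingHom_iff_of_finite_of_central` with `hE`, `h411` discharged.
Tate, Invent. Math. 2 (1966), Main Theorem and §2; Silverman, *AEC*, Thm. III.7.7(a).
[cite: Tate1966Endomorphisms, Main Theorem and §2] -/
theorem mem_span_range_tateEndRingHom_iff_of_finite_of_central_case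
    (hC : ∀ [Finite K] [W.IsElliptic], (ℓ : K) ≠ 0 → ∀ σ : Field.absoluteGaloisGroup K,
      (∀ x : AlgebraicClosure K, σ • x = x ^ Nat.card K) →
      (∃ c : ℤ_[ℓ], ∀ x : W.tateModule ℓ, σ • x = c • x) →
        ∀ g : Module.End ℤ_[ℓ] (W.tateModule ℓ),
          (∀ (τ : Field.absoluteGaloisGroup K) (x : W.tateModule ℓ), g (τ • x) = τ • g x) →
            ∃ n : ℕ, (ℓ : ℤ_[ℓ]) ^ n • g ∈ Submodule.span ℤ_[ℓ] (Set.range (tateEndRingHom W ℓ))) :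
    mem_span_range_tateEndRingHom_iff_of_finite W ℓ :=
  mem_span_range_tateEndRingHom_iff_of_finite_of_central W ℓ (mem_geomEndRing_iff_holds W)
    (Isogeny.exists_eq_comp_nsmul_of_geomTorsion_le_ker_holds W W) hC

end Literature.AlgebraicGeometry.Motives
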